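import Summits.ValiantsHypothesis.ValiantsHypothesis.Theorems.KPlusLogSqLawTropicalBToeplitzFiveHub
import Summits.ValiantsHypothesis.ValiantsHypothesis.Theorems.KPlusLogSqLawTropicalBToeplitzRotations

/-!
# Route `KPlusLogSqLaw`, crux `TropicalB` — Toeplitz sector: the KERNEL TABLE OF RECORD of Conjecture T's count `Φ_Toep(m)` (2026-08-26)

HONEST FRAMING.  Helper toward the registered stubs `stub_tropThin` / `stub_tropFat` of
`Cruxes/TropicalB/Lines/birth.lean` (crux `Summit.ValiantsHypothesis.ValiantsHypothesis.Theses.KPlusLogSqLaw.TropicalB`,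
ledger item `stmt-ValiantsHypothesis-19771`, route `KPlusLogSqLaw`; cell `pub-symmetroid`, seat `val-sym-trop-p3`,
2026-08-26).  One citable statement collecting what the kernel knows about `Φ_Toep(m)` (`Toeplitz.LinearInstanceBound m Φ` =
«`Φ_Toep(m) ≤ Φ`», all admissible sets included) after the cell's files `…ToeplitzSix … Ten` (certificates),
`…ToeplitzCornerPin` (monotonicity), `…ToeplitzSmallSizes` / `…ToeplitzFive` / `…ToeplitzFiveHub` (small rows), `…ToeplitzRotations`
(`≥ m`).  Conjecture T (`Φ_Toep(m) = O(m)`, or polynomial) is OPEN; nothing here bears on `TropicalB` for general designs,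
`KPlusLogSqLaw`, `MatrixDescartes` or `VP ≠ VNP`.

THE TABLE.  Exact: `Φ_Toep(0) = Φ_Toep(1) = 1`, `Φ_Toep(2) = 2`, `Φ_Toep(3) = 4`, `Φ_Toep(4) = 8`.  Bounded: `13 ≤ Φ_Toep(5) ≤ 16`.
Floors: `Φ_Toep(m) ≥ 18, 23, 26, 28` for `m ≥ 6, 7, 8, 9`, and `Φ_Toep(m) ≥ m` for all `m`; monotone in `m`; any linear constant
is `≥ 4`.  Located (not kernel): `Φ_Toep(5) = 13`, `Φ_Toep(6..9) ≥ 18, 23, 26, 28` fit `5m − 12` on `m ≤ 7`.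
-/

set_option linter.dupNamespace false
set_option autoImplicit false

namespace Summit.ValiantsHypothesis.ValiantsHypothesis.Theorems.KPlusLogSqLaw.Toeplitz

/-- **LOWER TABLE**: what `LinearInstanceBound m Φ` forces on `Φ`, by size. [folklore] -/
theorem lowerTable_of_linearInstanceBound {m Φ : ℕ} (h : LinearInstanceBound m Φ) :
    m ≤ Φ ∧ (3 ≤ m → 4 ≤ Φ) ∧ (4 ≤ m → 8 ≤ Φ) ∧ (5 ≤ m → 13 ≤ Φ) ∧ (6 ≤ m → 18 ≤ Φ) ∧ (7 ≤ m → 23 ≤ Φ) ∧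
      (8 ≤ m → 26 ≤ Φ) ∧ (9 ≤ m → 28 ≤ Φ) := by
  refine ⟨le_of_linearInstanceBound h, fun hm => ?_, fun hm => ?_, fun hm => ?_, fun hm => le_of_linearInstanceBound_six hm h,
    fun hm => le_of_linearInstanceBound_seven hm h, fun hm => le_of_linearInstanceBound_eight hm h,
    fun hm => le_of_linearInstanceBound_nine hm h⟩
  · exact (linearInstanceBound_three_iff Φ).mp (h.of_le hm)
  · exact (linearInstanceBound_four_iff Φ).mp (h.of_le hm)
  · by_contra hh
    exact not_linearInstanceBound_five_12 (((h.of_le hm).mono (by omega)))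

/-- **UPPER TABLE**: the bounds the kernel certifies for every linear Toeplitz instance of the given size. [folklore] -/
theorem upperTable :
    LinearInstanceBound 0 1 ∧ LinearInstanceBound 1 1 ∧ LinearInstanceBound 2 2 ∧ LinearInstanceBound 3 4 ∧
      LinearInstanceBound 4 8 ∧ LinearInstanceBound 5 16 :=
  ⟨(linearInstanceBound_zero_iff 1).mpr le_rfl, (linearInstanceBound_one_iff 1).mpr le_rfl, linearInstanceBound_two,
    linearInstanceBound_three, linearInstanceBound_four, linearInstanceBound_five_sixteen⟩

/-- **EXACT ROWS** `m ≤ 4` and the `m = 5` window, as iff / implications. [folklore] -/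
theorem exactTable (Φ : ℕ) :
    (LinearInstanceBound 0 Φ ↔ 1 ≤ Φ) ∧ (LinearInstanceBound 1 Φ ↔ 1 ≤ Φ) ∧ (LinearInstanceBound 2 Φ ↔ 2 ≤ Φ) ∧
      (LinearInstanceBound 3 Φ ↔ 4 ≤ Φ) ∧ (LinearInstanceBound 4 Φ ↔ 8 ≤ Φ) ∧
      (LinearInstanceBound 5 Φ → 13 ≤ Φ) ∧ (16 ≤ Φ → LinearInstanceBound 5 Φ) :=
  ⟨linearInstanceBound_zero_iff Φ, linearInstanceBound_one_iff Φ, linearInstanceBound_two_iff Φ,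
    linearInstanceBound_three_iff Φ, linearInstanceBound_four_iff Φ,
    fun h => (lowerTable_of_linearInstanceBound h).2.2.2.1 le_rfl, linearInstanceBound_five_of_sixteen_le Φ⟩

/-- **No linear Conjecture T with constant `< 4`, restated with the table**: `Φ_Toep(9) ≥ 28 > 3·9`. -/
theorem conjectureTLinear_constant_ge_four : ∀ C : ℕ, (∀ m : ℕ, LinearInstanceBound m (C * m)) → 4 ≤ C :=
  four_le_of_conjectureTLinear

end Summit.ValiantsHypothesis.ValiantsHypothesis.Theorems.KPlusLogSqLaw.Toeplitz
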